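import Summits.BirchSwinnertonDyer.Rank1Residual.X4.KimShaLength
import Summits.BirchSwinnertonDyer.Rank1Residual.X4.KimTamagawaDefect
import Summits.BirchSwinnertonDyer.Rank1Residual.Additive.SharpenedStatements
import HarnessLib

/-!
# Granted Kim's structure theorem (6): X4♯(unit-free) ⟺ Kim's Conjecture 1.10 on the rows with a
# Manin datum ∧ the datum-less residue — the END STATE of class X4 (r = 0) in the `∂^{(∞)}` currency
# (cell `b2b-bsdres`, seat additive-p4 gen 16, line V29; CLASS-CLOSURE §3.1 N11 / §3.2 N10, the §6
# end-state update promised in `CLASS-CLOSURE-INPUT-additive-p4.md`, importing team n1011's typed objects)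

HONEST FRAMING (cell `b2b-bsdres`, run/shared/lean/b2b/bsd-rank1-residual/, verbatim in every
file): the goal of the cell is to DELETE the COMBINATION-SHAPED residual classes of the
Birch–Swinnerton-Dyer formula for ALL analytic-rank `≤ 1` elliptic curves over `ℚ` — "full BSD
formula for every rank `≤ 1` curve in class `C`" assembled STRICTLY from published theorems — so
that the rank-`≤ 1` remainder becomes exactly the CONSTRUCTION-SHAPED classes, which are TYPED
(missing-input `Prop`s), NOT attempted. This is not "finishing BSD". Sub-cell additive-p4 (X3♯/X4♯
direct): research route on the CONSTRUCTION-SHAPED class X4; a REDUCTION of the typed conjecture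
`X4SharpUnitFree` to typed per-pair statements, not a proof of it; the label X4 is UNCHANGED; nothing
is booked by this file. Theorems only (no definition, no named fact minted). NOTHING open is
assumed as a fact: Kim's clause (6) enters as an explicit per-row HYPOTHESIS in the typed shape
`X4.KimShaLengthRankZeroAt` (cc-typer-1, `X4/KimShaLength.lean`), Kim's Conjecture 1.10 as the typed
predicate `X4.KimTamagawaDefectAt` (team n1011, `X4/KimTamagawaDefect.lean`).

## What this file proves

* §1 **per pair** `X4RankZero.missingPPartAt_iff_kimTamagawaDefectAt_of_kimShaLength`: in analytic
  rank `0`, with GZK, modularity and `E[p]` irreducible, GRANTED clause (6) at `(W, p, f)` in BSD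
  currency (`X4.KimShaLengthRankZeroAt W p f`: `L(E,1)/Ω = q`, `∂^{(∞)}(δ̃) = d`,
  `ord_p q = ord_p #Ш(p) + d`), the missing output `Typed.MissingPPartAt W p` (= Miller's `BSD(E,p)`
  under GZK) is EQUIVALENT to Kim's Conjecture 1.10 at the pair, `X4.KimTamagawaDefectAt W p f`
  (`∂^{(∞)}(δ̃) = ord_p ∏_v c_v`) — cc-typer-1's `X4.bsdp_iff_eq_tamagawa_of_rankZero_witness` read
  through the `ℕ∞`-valued `kuriharaPartialInfty`. Class-free (any `W` with `E[p]` irreducible).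
* §2 **class level** `x4SharpUnitFree_iff_kimTamagawaDefect_of_kimShaLength`: GRANTED clause (6) on
  every X4 ∧ `r_an = 0` ∧ surj(p) pair for every modular datum `D` with `p ∤ c_D` and the period
  transfer (the binder family of the tree's Kim-type facts), the typed conjecture `X4SharpUnitFree`
  is EQUIVALENT to: (i) Kim's Conjecture 1.10 `X4.KimTamagawaDefectAt W p D.f` on every such pair and
  datum, AND (ii) the missing output on the pairs admitting NO such datum (the MANIN residue of gen
  14's end state, here for both halves). §3 the same at the single prime `p = 3` (RESIDUAL-MAP §I N11:
  `n11_rankZero_three_iff_kimTamagawaDefect_of_kimShaLength`).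

STATUS OF THE HYPOTHESIS (6) (`X4.KimShaLengthRankZeroAt`, over the tree's CYCLIC Kolyvagin levels):
at `p ≥ 5` it is Kim 2026 Thm. 1.8 (6) (PUBLISHED; `ρ̄` onto, Manin constant prime to `p`; in the
kernel: the unit case `X4.kimShaLengthRankZeroAt_of_kim_of_kuriharaUnitAt`, the `≤` inequality from
`Kim2026.rankZero_le_padicValNat_sha_of_kuriharaNumber_ne_zero` (cyclic levels) — the `≥` inequality
fact `Kim2026.rankZero_padicValNat_sha_add_le_of_forall_pow_dvd_kuriharaNumber` quantifies over Kim's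
literal `𝒩_k` and does not yet meet the cyclic `∂^{(∞)}`; see the seat's INBOX note); at `p = 3` it is
ANNOUNCED (Kim, arXiv:2505.09121 Thm. 1.1, large image = the 3-adic tower; OPEN hypothesis
`Kim2025.…_of_towerSurj_OPEN`). So §2/§3 say: **the residue of N11 ∪ (N10 ∩ X4) IS Kim's Conjecture
1.10 (plus the datum-less rows), the day clause (6) is available on the rows** — at `p ≥ 5` a
published theorem, at `p = 3` an announced one. Nothing here closes a class; X4 stays
CONSTRUCTION-SHAPED; nothing is booked.

References: Kim 2026 [Kim2022StructureSelmer] Thm. 1.8 (6), §1.5.1, Conj. 1.9 (journal; = v4 Thm.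
1.9, Conj. 1.10); Kim 2025 arXiv:2505.09121 Thm. 1.1 (PRE; context only); Miller 2011
[Miller2011LMS] Def. 1.1.
-/

noncomputable section

open scoped Classical MatrixGroups ModularForm

open CongruenceSubgroup WeierstrassCurve Literature.NumberTheory.EllipticCurves
  Literature.NumberTheory.EllipticCurves.ModularForms
  Literature.NumberTheory.EllipticCurves.Rank1Residual
  Literature.NumberTheory.EllipticCurves.Rank1Residual.Typed

namespace Summit.BirchSwinnertonDyer.Rank1Residual.Additive

/-! ### §1 Per pair: granted (6), the missing output ⟺ Conjecture 1.10 at the pair -/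

section PerPair

variable (W : WeierstrassCurve ℚ) [W.IsElliptic] [W.IsGloballyMinimal] (p : ℕ) [Fact p.Prime]

/-- **Granted Kim's clause (6) at `(W, p, f)`, `Typed.MissingPPartAt W p ⟺ X4.KimTamagawaDefectAt W p f`.**
Analytic rank `0` (modularity `hmod` reads it as `L(E,1) ≠ 0`), GZK (`rank = r_an`, `Ш` finite),
`E[p]` irreducible (`p ∤ #E(ℚ)_tors`); (6) in BSD currency = `X4.KimShaLengthRankZeroAt W p f`
(`L(E,1)/Ω = q`, `∂^{(∞)}(δ̃) = d ∈ ℕ`, `ord_p q = ord_p #Ш(p) + d`). Then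
`#Ш_an = q·#tors²/∏c`, so `ord_p #Ш_an = ord_p #Ш ⟺ d = ord_p ∏_v c_v ⟺ ∂^{(∞)}(δ̃) = ord_p ∏_v c_v`.
Class-free; (6) is a HYPOTHESIS (published at `p ≥ 5`, announced at `p = 3`), the conjecture a typed
predicate — nothing open is assumed. [cite: Kim2022StructureSelmer, Thm. 1.9 (6) and Conj. 1.10 (PDF p. 8)]
[cite: Miller2011LMS, Def. 1.1 (arXiv:1010.2431 p. 3)] -/
theorem X4RankZero.missingPPartAt_iff_kimTamagawaDefectAt_of_kimShaLength
    (hGZK : rank_eq_analyticRank_of_analyticRank_le_one) (hmod : hasEntireLFunction_rat)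
    (hr : W.analyticRank = 0) (hirr : W.HasIrreducibleModPGaloisRep p)
    {N : ℕ} (f : CuspForm (Gamma0 N) 2) (h6 : X4.KimShaLengthRankZeroAt W p f) :
    MissingPPartAt W p ↔ X4.KimTamagawaDefectAt W p f := by
  have hL : W.entireLFunction 1 ≠ 0 := (W.analyticRank_eq_zero_iff_holds (hmod W)).mp hr
  have hr1 : W.analyticRank ≤ 1 := by rw [hr]; exact zero_le_one
  obtain ⟨hmw, hfin⟩ := hGZK W hr1
  haveI : Finite W.sha := hfin
  obtain ⟨q, d, hq, hd, hval⟩ := h6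
  have key := X4.bsdp_iff_eq_tamagawa_of_rankZero_witness W p hmw hfin hL hirr hq hval
  rw [X4.KimTamagawaDefectAt, hd, ENat.coe_inj]
  exact ⟨fun h ↦ key.mp (bsdp_of_missingPPartAt W p hGZK hr1 h),
    fun h ↦ missingPPartAt_of_bsdp W p (key.mpr h)⟩

/-- **Per row, with the datum quantified** (the shape the class statements use): granted (6) for
every admissible datum of the row, the missing output holds iff [Conjecture 1.10 holds for every
admissible datum AND (if the row admits no admissible datum) the missing output holds]. An
"admissible datum" is a modular parametrisation datum `D` with `p ∤ c_D` and the period transfer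
`Ω(W) = u·Ω⁺_{D.f}`, `|u|_p = 1` (the binder family of the tree's Kim-type facts). Bookkeeping.
[cite: Kim2022StructureSelmer, Thm. 1.9 (6) and Conj. 1.10 (PDF p. 8)] [cite: Miller2011LMS, Def. 1.1] -/
theorem X4RankZero.missingPPartAt_iff_forall_kimTamagawaDefectAt_of_kimShaLength
    (hGZK : rank_eq_analyticRank_of_analyticRank_le_one) (hmod : hasEntireLFunction_rat)
    (hr : W.analyticRank = 0) (hirr : W.HasIrreducibleModPGaloisRep p)
    (h6 : ∀ {N : ℕ} [NeZero N] (D : ModularParametrizationData W N), ¬ (p : ℤ) ∣ D.maninConstant →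
      (∃ u : ℚ, ‖(u : ℚ_[p])‖ = 1 ∧ W.realPeriodRat = u * plusPeriod D.f) →
      X4.KimShaLengthRankZeroAt W p D.f) :
    MissingPPartAt W p ↔
      ((∀ {N : ℕ} [NeZero N] (D : ModularParametrizationData W N), ¬ (p : ℤ) ∣ D.maninConstant →
          (∃ u : ℚ, ‖(u : ℚ_[p])‖ = 1 ∧ W.realPeriodRat = u * plusPeriod D.f) →
          X4.KimTamagawaDefectAt W p D.f) ∧
        ((∀ (N : ℕ) [NeZero N] (D : ModularParametrizationData W N), (p : ℤ) ∣ D.maninConstant ∨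
            ¬ ∃ u : ℚ, ‖(u : ℚ_[p])‖ = 1 ∧ W.realPeriodRat = u * plusPeriod D.f) →
          MissingPPartAt W p)) := by
  constructor
  · intro h
    exact ⟨fun D hc hper ↦
      (X4RankZero.missingPPartAt_iff_kimTamagawaDefectAt_of_kimShaLength W p hGZK hmod hr hirr D.f
        (h6 D hc hper)).mp h, fun _ ↦ h⟩
  · rintro ⟨hconj, hres⟩
    by_cases hD : ∃ (N : ℕ) (_ : NeZero N) (D : ModularParametrizationData W N),
        ¬ (p : ℤ) ∣ D.maninConstant ∧ ∃ u : ℚ, ‖(u : ℚ_[p])‖ = 1 ∧ W.realPeriodRat = u * plusPeriod D.f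
    · obtain ⟨N, hN, D, hc, hper⟩ := hD
      exact (X4RankZero.missingPPartAt_iff_kimTamagawaDefectAt_of_kimShaLength W p hGZK hmod hr hirr
        D.f (h6 D hc hper)).mpr (hconj D hc hper)
    · refine hres fun N _ D ↦ ?_
      by_contra hnot
      obtain ⟨h1, h2⟩ := not_or.mp hnot
      exact hD ⟨N, inferInstance, D, h1, not_not.mp h2⟩

end PerPair

/-! ### §2 Class level: X4♯(unit-free) ⟺ Conjecture 1.10 on the datum rows ∧ the datum-less residue -/

/-- **Granted Kim's clause (6) on the rows, X4♯(unit-free) ⟺ Kim's Conjecture 1.10 on every X4 ∧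
`r_an = 0` ∧ surj(p) pair with an admissible datum ∧ the missing output on the datum-less pairs.**
Hypothesis `h6` = clause (6) in BSD currency (`X4.KimShaLengthRankZeroAt W p D.f`) for every X4 ∧
`r_an = 0` ∧ surj(p) pair and every admissible datum `D` (`p ∤ c_D`, period transfer) — PUBLISHED at
`p ≥ 5` (Kim 2026 Thm. 1.8 (6)), ANNOUNCED at `p = 3` under the 3-adic tower (Kim 2025 Thm. 1.1);
carried as a hypothesis, never asserted. Conclusion: the typed conjecture `X4SharpUnitFree` (∀ such
pairs, `ord_p #Ш = ord_p #Ш_an`) is equivalent to (i) `X4.KimTamagawaDefectAt W p D.f`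
(`∂^{(∞)}(δ̃) = ord_p ∏_v c_v`, Kim's Conj. 1.10, typed by team n1011) for every such pair and
admissible datum, AND (ii) `Typed.MissingPPartAt W p` on the pairs with NO admissible datum. So — the
day (6) is available on the rows — the residue of class X4 (rank `0`; RESIDUAL-MAP §I N11 ∪ N10 ∩ X4)
is EXACTLY Kim's Conjecture 1.10 on the datum rows plus the datum-less rows. Nothing open assumed;
X4 stays CONSTRUCTION-SHAPED; nothing booked. [cite: Kim2022StructureSelmer, Thm. 1.9 (6) and Conj. 1.10 (PDF p. 8)]
[cite: Miller2011LMS, §1 and Def. 1.1] -/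
theorem x4SharpUnitFree_iff_kimTamagawaDefect_of_kimShaLength
    (hGZK : rank_eq_analyticRank_of_analyticRank_le_one) (hmod : hasEntireLFunction_rat)
    (h6 : ∀ (W : WeierstrassCurve ℚ) [W.IsElliptic] [W.IsGloballyMinimal] (p : ℕ) [Fact p.Prime],
      W.analyticRank = 0 → ClassX4 W p → Surj W p →
      ∀ {N : ℕ} [NeZero N] (D : ModularParametrizationData W N), ¬ (p : ℤ) ∣ D.maninConstant →
      (∃ u : ℚ, ‖(u : ℚ_[p])‖ = 1 ∧ W.realPeriodRat = u * plusPeriod D.f) →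
      X4.KimShaLengthRankZeroAt W p D.f) :
    X4SharpUnitFree ↔
      (∀ (W : WeierstrassCurve ℚ) [W.IsElliptic] [W.IsGloballyMinimal] (p : ℕ) [Fact p.Prime],
          W.analyticRank = 0 → ClassX4 W p → Surj W p →
          ∀ {N : ℕ} [NeZero N] (D : ModularParametrizationData W N), ¬ (p : ℤ) ∣ D.maninConstant →
          (∃ u : ℚ, ‖(u : ℚ_[p])‖ = 1 ∧ W.realPeriodRat = u * plusPeriod D.f) →
          X4.KimTamagawaDefectAt W p D.f) ∧
      (∀ (W : WeierstrassCurve ℚ) [W.IsElliptic] [W.IsGloballyMinimal] (p : ℕ) [Fact p.Prime],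
          W.analyticRank = 0 → ClassX4 W p → Surj W p →
          (∀ (N : ℕ) [NeZero N] (D : ModularParametrizationData W N), (p : ℤ) ∣ D.maninConstant ∨
            ¬ ∃ u : ℚ, ‖(u : ℚ_[p])‖ = 1 ∧ W.realPeriodRat = u * plusPeriod D.f) →
          MissingPPartAt W p) := by
  constructor
  · intro hX4
    refine ⟨fun W _ _ p _ hr hX hs N _ D hc hper ↦ ?_, fun W _ _ p _ hr hX hs _ ↦ hX4 W p hr hX hs⟩
    exact ((X4RankZero.missingPPartAt_iff_forall_kimTamagawaDefectAt_of_kimShaLength W p hGZK hmod hr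
      hX.2.2 (h6 W p hr hX hs)).mp (hX4 W p hr hX hs)).1 D hc hper
  · rintro ⟨hconj, hres⟩ W _ _ p _ hr hX hs
    exact (X4RankZero.missingPPartAt_iff_forall_kimTamagawaDefectAt_of_kimShaLength W p hGZK hmod hr
      hX.2.2 (h6 W p hr hX hs)).mpr ⟨fun D hc hper ↦ hconj W p hr hX hs D hc hper, hres W p hr hX hs⟩

/-! ### §3 The single prime `p = 3` (RESIDUAL-MAP §I N11) -/

/-- **N11 (X4 ∧ `r_an = 0` ∧ `p = 3` ∧ surj(3)): granted clause (6) at `3` on the rows** (ANNOUNCED: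
Kim, arXiv:2505.09121 Thm. 1.1 under the 3-adic tower; typed OPEN hypothesis
`Kim2025.…_of_towerSurj_OPEN` — here in the shape `X4.KimShaLengthRankZeroAt W 3 D.f`, a hypothesis),
**the N11 statement (`ord₃ #Ш = ord₃ #Ш_an` on every such pair) ⟺ Kim's Conjecture 1.10 at `3` on
every such pair with an admissible datum ∧ the missing output on the datum-less pairs.** Per the
CLASS-CLOSURE plan: the class's irreducible residue named precisely. Nothing open assumed; the label
of N11 is UNCHANGED; nothing booked. [cite: Kim2022StructureSelmer, Thm. 1.9 (6) and Conj. 1.10 (PDF p. 8)]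
[cite: Miller2011LMS, §1 and Def. 1.1] -/
theorem n11_rankZero_three_iff_kimTamagawaDefect_of_kimShaLength
    (hGZK : rank_eq_analyticRank_of_analyticRank_le_one) (hmod : hasEntireLFunction_rat)
    (h6 : ∀ (W : WeierstrassCurve ℚ) [W.IsElliptic] [W.IsGloballyMinimal],
      haveI : Fact (Nat.Prime 3) := ⟨Nat.prime_three⟩
      W.analyticRank = 0 → ClassX4 W 3 → Surj W 3 →
      ∀ {N : ℕ} [NeZero N] (D : ModularParametrizationData W N), ¬ (3 : ℤ) ∣ D.maninConstant →
      (∃ u : ℚ, ‖(u : ℚ_[3])‖ = 1 ∧ W.realPeriodRat = u * plusPeriod D.f) →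
      X4.KimShaLengthRankZeroAt W 3 D.f) :
    haveI : Fact (Nat.Prime 3) := ⟨Nat.prime_three⟩
    (∀ (W : WeierstrassCurve ℚ) [W.IsElliptic] [W.IsGloballyMinimal],
        W.analyticRank = 0 → ClassX4 W 3 → Surj W 3 → MissingPPartAt W 3) ↔
      (∀ (W : WeierstrassCurve ℚ) [W.IsElliptic] [W.IsGloballyMinimal],
          W.analyticRank = 0 → ClassX4 W 3 → Surj W 3 →
          ∀ {N : ℕ} [NeZero N] (D : ModularParametrizationData W N), ¬ (3 : ℤ) ∣ D.maninConstant →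
          (∃ u : ℚ, ‖(u : ℚ_[3])‖ = 1 ∧ W.realPeriodRat = u * plusPeriod D.f) →
          X4.KimTamagawaDefectAt W 3 D.f) ∧
      (∀ (W : WeierstrassCurve ℚ) [W.IsElliptic] [W.IsGloballyMinimal],
          W.analyticRank = 0 → ClassX4 W 3 → Surj W 3 →
          (∀ (N : ℕ) [NeZero N] (D : ModularParametrizationData W N), (3 : ℤ) ∣ D.maninConstant ∨
            ¬ ∃ u : ℚ, ‖(u : ℚ_[3])‖ = 1 ∧ W.realPeriodRat = u * plusPeriod D.f) →
          MissingPPartAt W 3) := by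
  haveI : Fact (Nat.Prime 3) := ⟨Nat.prime_three⟩
  constructor
  · intro hN11
    refine ⟨fun W _ _ hr hX hs N _ D hc hper ↦ ?_, fun W _ _ hr hX hs _ ↦ hN11 W hr hX hs⟩
    exact ((X4RankZero.missingPPartAt_iff_forall_kimTamagawaDefectAt_of_kimShaLength W 3 hGZK hmod hr
      hX.2.2 (h6 W hr hX hs)).mp (hN11 W hr hX hs)).1 D hc hper
  · rintro ⟨hconj, hres⟩ W _ _ hr hX hs
    exact (X4RankZero.missingPPartAt_iff_forall_kimTamagawaDefectAt_of_kimShaLength W 3 hGZK hmod hr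
      hX.2.2 (h6 W hr hX hs)).mpr ⟨fun D hc hper ↦ hconj W hr hX hs D hc hper, hres W hr hX hs⟩

end Summit.BirchSwinnertonDyer.Rank1Residual.Additive

end
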